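import Summits.Ventures.PercRepro.RankLevelSetBiIndepLR

/-! # RankLevelSetBiIndepLRSplit — THE INDUCTIVE STEP OF THE LIKELIHOOD-RATIO MONOTONICITY (LR) AT A SECOND ELEMENT,
AND ITS CROSS TERM (night-1 g26; dossier §38.11)

For `y ≠ z` in `E` split the marked profiles of `M` at `y` by the membership of `z`:
`a_p = a¹_p + a²_p` and `b_p = b¹_p + b²_p` with `a¹_p = #{Q ∈ D_{p+1} : y ∈ Q, z ∈ Q}`, `a²_p = #{… z ∉ Q}`,
`b¹_p = #{Z ∈ D_p : y ∉ Z, z ∈ Z}`, `b²_p = #{… z ∉ Z}` (`yThroughCount_split`, `yAvoidCount_split`) — the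
`(a¹, b¹)` array is the (LR) array of the pair `(M ／ z, M ＼ z)` and `(a², b²)` that of `(M ＼ z, M ／ z)`, i.e. the
same statement for the two minors' pairs. The consecutive TP2 inequality of the sum decomposes EXACTLY into the
TP2 inequalities of the two parts and ONE cross term
`(Cmid)`: `a¹_{p+1} b²_p + a²_{p+1} b¹_p ≤ a¹_p b²_{p+1} + a²_p b¹_{p+1}` (`LRCross`, a `Prop`, NOT asserted):
`tp2_of_split` / `biIndepLRStep_of_split`. CENSUS (night-1 g26): the cross term (Cmid) has 0 failures on every
matroid n ≤ 8 (65,832 `(M, y, z)` instances), every theta graph with ≤ 13 edges (20,354), 6,710 random GF(2/3/5)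
instances on 10 … 12 elements and 6,600 series extensions; the two PART inequalities hold on n ≤ 8 and random /
series instances but FAIL on Θ(1,2,3,3,4) when `y` and `z` are in series (126·69 > 36·240 at `p = 4`) — so, as for
(★★) (§37.1), the element induction does not close termwise: the cross term is signed, the recursive terms are not.
Nothing here asserts (LR) or (Cmid); every declaration has a docstring; imports: the cell's own modules and Mathlib
only. Axioms: standard. -/

namespace PercRepro

open Set Matroid

variable {α : Type} (M : Matroid α) [M.Finite]

omit [M.Finite] in
/-- `a¹_p = #{Q ∈ D_{p+1} : y ∈ Q ∧ z ∈ Q}`: the through-`y` count with `z` contained. -/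
noncomputable def yzThroughBoth (y z : α) (p : ℕ) : ℕ := {Q ∈ biIndep M (p + 1) | y ∈ Q ∧ z ∈ Q}.ncard

omit [M.Finite] in
/-- `a²_p = #{Q ∈ D_{p+1} : y ∈ Q ∧ z ∉ Q}`: the through-`y` count with `z` avoided. -/
noncomputable def yzThroughAvoid (y z : α) (p : ℕ) : ℕ := {Q ∈ biIndep M (p + 1) | y ∈ Q ∧ z ∉ Q}.ncard

omit [M.Finite] in
/-- `b¹_p = #{Z ∈ D_p : y ∉ Z ∧ z ∈ Z}`: the avoid-`y` count with `z` contained. -/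
noncomputable def yzAvoidThrough (y z : α) (p : ℕ) : ℕ := {Z ∈ biIndep M p | y ∉ Z ∧ z ∈ Z}.ncard

omit [M.Finite] in
/-- `b²_p = #{Z ∈ D_p : y ∉ Z ∧ z ∉ Z}`: the avoid-`y` count with `z` avoided. -/
noncomputable def yzAvoidBoth (y z : α) (p : ℕ) : ℕ := {Z ∈ biIndep M p | y ∉ Z ∧ z ∉ Z}.ncard

/-- A filtered family of bi-independent sets splits by the membership of `z`. -/
lemma ncard_filter_split_mem (𝒟 : Set (Set α)) (h𝒟 : 𝒟.Finite) (P : Set α → Prop) (z : α) :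
    {S ∈ 𝒟 | P S}.ncard = {S ∈ 𝒟 | P S ∧ z ∈ S}.ncard + {S ∈ 𝒟 | P S ∧ z ∉ S}.ncard := by
  have hfin1 : {S ∈ 𝒟 | P S ∧ z ∈ S}.Finite := h𝒟.subset (fun S hS => hS.1)
  have hfin2 : {S ∈ 𝒟 | P S ∧ z ∉ S}.Finite := h𝒟.subset (fun S hS => hS.1)
  have hdisj : Disjoint {S ∈ 𝒟 | P S ∧ z ∈ S} {S ∈ 𝒟 | P S ∧ z ∉ S} := by
    rw [Set.disjoint_left]
    rintro S ⟨-, -, hz⟩ ⟨-, -, hz'⟩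
    exact hz' hz
  rw [← Set.ncard_union_eq hdisj hfin1 hfin2]
  congr 1
  ext S
  simp only [Set.mem_union, Set.mem_setOf_eq]
  tauto

/-- **The through-`y` count splits at `z`**: `a_p = a¹_p + a²_p`. -/
lemma yThroughCount_split (y z : α) (p : ℕ) :
    yThroughCount M y p = yzThroughBoth M y z p + yzThroughAvoid M y z p :=
  ncard_filter_split_mem (biIndep M (p + 1)) (biIndep_finite M (p + 1)) (fun Q => y ∈ Q) z

/-- **The avoid-`y` count splits at `z`**: `b_p = b¹_p + b²_p`. -/
lemma yAvoidCount_split (y z : α) (p : ℕ) :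
    yAvoidCount M y p = yzAvoidThrough M y z p + yzAvoidBoth M y z p :=
  ncard_filter_split_mem (biIndep M p) (biIndep_finite M p) (fun Z => y ∉ Z) z

omit [M.Finite] in
/-- **THE CROSS TERM (Cmid)** (a `Prop`, NOT asserted): for every `y ≠ z` in `E` and every `p`,
`a¹_{p+1} b²_p + a²_{p+1} b¹_p ≤ a¹_p b²_{p+1} + a²_p b¹_{p+1}` — among pairs `(S, S')` of bi-independent sets with
`y ∈ S ∖ S'`, `z` in exactly one of them and `#S + #S' = 2p + 2`, the balanced sizes `(p+1, p+1)` are at least as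
many as the split `(p+2, p)`. Census-clean (dossier §38.11). -/
def LRCross : Prop :=
  ∀ y ∈ M.E, ∀ z ∈ M.E, y ≠ z → ∀ p : ℕ,
    yzThroughBoth M y z (p + 1) * yzAvoidBoth M y z p + yzThroughAvoid M y z (p + 1) * yzAvoidThrough M y z p ≤
      yzThroughBoth M y z p * yzAvoidBoth M y z (p + 1) + yzThroughAvoid M y z p * yzAvoidThrough M y z (p + 1)

/-- **The arithmetic of the split**: the consecutive TP2 inequality of a sum of two 2-row arrays follows from the
TP2 inequalities of the parts and the cross term. -/
lemma tp2_of_split {a₁ a₂ b₁ b₂ : ℕ → ℕ} {p : ℕ}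
    (h1 : a₁ (p + 1) * b₁ p ≤ a₁ p * b₁ (p + 1)) (h2 : a₂ (p + 1) * b₂ p ≤ a₂ p * b₂ (p + 1))
    (hc : a₁ (p + 1) * b₂ p + a₂ (p + 1) * b₁ p ≤ a₁ p * b₂ (p + 1) + a₂ p * b₁ (p + 1)) :
    (a₁ (p + 1) + a₂ (p + 1)) * (b₁ p + b₂ p) ≤ (a₁ p + a₂ p) * (b₁ (p + 1) + b₂ (p + 1)) := by
  nlinarith [h1, h2, hc]

/-- **THE INDUCTIVE STEP**: if at every `y ≠ z` the two parts satisfy their consecutive TP2 inequalities (the (LR)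
statement of the two minors' pairs) and the cross term holds, then `M` satisfies the consecutive form of (LR). -/
theorem biIndepLRStep_of_split (z : α) (hz : z ∈ M.E)
    (h1 : ∀ y ∈ M.E, y ≠ z → ∀ p, yzThroughBoth M y z (p + 1) * yzAvoidThrough M y z p ≤
      yzThroughBoth M y z p * yzAvoidThrough M y z (p + 1))
    (h2 : ∀ y ∈ M.E, y ≠ z → ∀ p, yzThroughAvoid M y z (p + 1) * yzAvoidBoth M y z p ≤
      yzThroughAvoid M y z p * yzAvoidBoth M y z (p + 1))
    (hc : LRCross M)
    (hzz : ∀ p, yThroughCount M z (p + 1) * yAvoidCount M z p ≤ yThroughCount M z p * yAvoidCount M z (p + 1)) :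
    BiIndepLRStep M := by
  intro y hy p
  by_cases hyz : y = z
  · subst hyz; exact hzz p
  · rw [yThroughCount_split M y z, yThroughCount_split M y z, yAvoidCount_split M y z, yAvoidCount_split M y z]
    exact tp2_of_split (h1 y hy hyz p) (h2 y hy hyz p) (hc y hy z hz hyz p)

end PercRepro
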